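import Literature.Analysis.OperatorTheory.LocalSqrtNearOneProofs
import Mathlib.Analysis.Calculus.FDeriv.Mul
import Mathlib.Analysis.Calculus.FDeriv.Bilinear
import Mathlib.Analysis.Calculus.ContDiff.Operations
import Mathlib.Analysis.Normed.Operator.Bilinear
import Mathlib.Topology.Algebra.Module.FiniteDimension
import Mathlib.LinearAlgebra.Dual.Lemmas
import Mathlib.Analysis.Normed.Module.FiniteDimension

/-!
# The osculating unitary frame of a Kähler metric (Voisin, Prop. 3.14): model-space analysis

Model-space (chart) analysis behind Voisin's osculation argument for the Kähler identities
(C. Voisin, *Hodge Theory and Complex Algebraic Geometry I* (2002), Prop. 3.14: a Hermitian metric is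
Kähler iff it osculates the flat metric to order `2` in suitable holomorphic coordinates; Prop. 6.5:
the Kähler identities, proved at a point in such coordinates). Everything happens on a
finite-dimensional real normed space `E` (the model space of a chart) carrying

* a positive definite symmetric bilinear form `g₀` (the metric at the centre `c` of the chart),
* a family `Ĝ : E → (E →L[ℝ] E →L[ℝ] ℝ)` of symmetric bilinear forms (the coordinate expression of
  the metric) with `Ĝ c = g₀` and first jet `D = DĜ(c)`,
* the Koszul map `B` of this jet: `g₀ (B u v) w + g₀ v (B u w) = D u v w`, `B u v = B v u`
  (Levi-Civita connection on constant fields; under the Kähler condition `B` is moreover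
  `ℂ`-bilinear, `KaehlerOsculatingAlgebraProofs.lean`),

and produces the **osculating unitary frame map** `M y = √(Q y) ∘ A y : E →L[ℝ] E`, where
`A y = 1 + B(y - c)` is the differential of the quadratic (holomorphic) coordinate change
`y ↦ (y - c) + ½ B(y - c, y - c)`, `Q y` is the `g₀`-Gram operator of the transported metric
(`g₀ (Q y a) b = Ĝ y (A y⁻¹ a) (A y⁻¹ b)`) and `√` the smooth square root near `1` of the Banach
algebra `E →L[ℝ] E` (`LocalSqrtNearOneProofs.lean`). Main statements:

* `exists_riesz` (§1): the `g₀`-Riesz map `S : (E →L[ℝ] ℝ) →L[ℝ] E` (finite dimension);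
* §2: the `g₀`-transpose `σ X = S ∘ (g₀ ∘ X)ᵗ` is a continuous anti-homomorphism fixing exactly the
  `g₀`-self-adjoint operators;
* `exists_koszul` (§3): existence of the Koszul map with its defining identity, and its symmetry
  and metric compatibility;
* §4: `A c = 1`, `DA(c) = B`, `Q c = 1`, `Q y` is `g₀`-self-adjoint, smoothness of `A`, `Q`;
  with `M y := √(Q y) ∘ A y` (in the sequel file): `M c = 1`, **`M y` is an isometry
  `(E, Ĝ y) → (E, g₀)`** near `c`, **`DM(c) = B` is symmetric** (so that the test forms
  `η ∘ M^{⊗k}` have vanishing exterior derivative at `c`), smoothness, and `ℂ`-linearity when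
  `Ĝ`, `g₀` are Hermitian and `B` is `ℂ`-bilinear.

No definitions are introduced: all objects are written out (local notations).

## References

* C. Voisin, *Hodge Theory and Complex Algebraic Geometry I* (2002), §3.1.3 Thm. 3.13, Prop. 3.14;
  §6.1.1 Prop. 6.5. [Voisin2002]
* P. Griffiths, J. Harris, *Principles of Algebraic Geometry* (1978), p. 107. [GriffithsHarris1978]
-/

noncomputable section

open scoped Topology ContDiff
open Filter ContinuousLinearMap

namespace Literature.Geometry.Kaehler

section Riesz

variable {E : Type*} [NormedAddCommGroup E] [NormedSpace ℝ E] [FiniteDimensional ℝ E]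

omit [FiniteDimensional ℝ E] in
/-- A positive definite bilinear form is nondegenerate: `g₀ a = 0 → a = 0`. [folklore] -/
theorem eq_zero_of_bilin_pos (g₀ : E →L[ℝ] E →L[ℝ] ℝ) (hpos : ∀ a, a ≠ 0 → 0 < g₀ a a) {a : E}
    (h : g₀ a = 0) : a = 0 := by
  by_contra ha
  have := hpos a ha
  rw [h, zero_apply] at this
  exact lt_irrefl _ this

omit [FiniteDimensional ℝ E] in
/-- Extensionality through a positive definite bilinear form: if `g₀ a w = g₀ b w` for all `w`
then `a = b`. [folklore] -/
theorem bilin_ext (g₀ : E →L[ℝ] E →L[ℝ] ℝ) (hpos : ∀ a, a ≠ 0 → 0 < g₀ a a) {a b : E}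
    (h : ∀ w, g₀ a w = g₀ b w) : a = b := by
  have h0 : g₀ (a - b) = 0 := by
    ext w
    rw [map_sub, sub_apply, h w, sub_self, zero_apply]
  exact sub_eq_zero.1 (eq_zero_of_bilin_pos g₀ hpos h0)

/-- **The Riesz map of a positive definite bilinear form** on a finite-dimensional space: there is
a continuous linear `S : E* → E` with `g₀ (S ℓ) = ℓ` and `S (g₀ v) = v` (the flat map
`v ↦ g₀ v` is injective, hence bijective by a dimension count). [folklore] -/
theorem exists_riesz (g₀ : E →L[ℝ] E →L[ℝ] ℝ) (hpos : ∀ a, a ≠ 0 → 0 < g₀ a a) :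
    ∃ S : (E →L[ℝ] ℝ) →L[ℝ] E, (∀ ℓ w, g₀ (S ℓ) w = ℓ w) ∧ (∀ v, S (g₀ v) = v) := by
  set f : E →ₗ[ℝ] (E →L[ℝ] ℝ) := (g₀ : E →L[ℝ] E →L[ℝ] ℝ).toLinearMap with hf
  have hinj : Function.Injective f := by
    intro a b hab
    refine bilin_ext g₀ hpos fun w ↦ ?_
    have := congrArg (fun ℓ : E →L[ℝ] ℝ ↦ ℓ w) hab
    simpa [hf] using this
  have hdim : Module.finrank ℝ E = Module.finrank ℝ (E →L[ℝ] ℝ) := by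
    rw [LinearEquiv.finrank_eq (LinearMap.toContinuousLinearMap : (E →ₗ[ℝ] ℝ) ≃ₗ[ℝ] E →L[ℝ] ℝ).symm]
    exact (Subspace.dual_finrank_eq).symm
  have hsurj : Function.Surjective f :=
    (LinearMap.injective_iff_surjective_of_finrank_eq_finrank hdim).1 hinj
  let e : E ≃ₗ[ℝ] (E →L[ℝ] ℝ) := LinearEquiv.ofBijective f ⟨hinj, hsurj⟩
  refine ⟨LinearMap.toContinuousLinearMap (e.symm : (E →L[ℝ] ℝ) →ₗ[ℝ] E), fun ℓ w ↦ ?_, fun v ↦ ?_⟩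
  · have h1 : g₀ (e.symm ℓ) = ℓ := e.apply_symm_apply ℓ
    exact congrArg (fun m : E →L[ℝ] ℝ ↦ m w) h1
  · exact e.symm_apply_apply v

end Riesz

section Transpose

variable {E : Type*} [NormedAddCommGroup E] [NormedSpace ℝ E]
  (g₀ : E →L[ℝ] E →L[ℝ] ℝ) (S : (E →L[ℝ] ℝ) →L[ℝ] E)

/-- The `g₀`-transpose `σ X = S ∘ (g₀ ∘ X)ᵗ` of an operator (`g₀ (σ X a) b = g₀ a (X b)`). -/
local notation "σ[" X "]" => ContinuousLinearMap.comp S (ContinuousLinearMap.flip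
  (ContinuousLinearMap.comp g₀ X))

/-- Defining identity of the transpose: `g₀ (σ X a) b = g₀ (X b) a`. [folklore] -/
theorem bilin_transpose_apply (hS : ∀ ℓ w, g₀ (S ℓ) w = ℓ w) (X : E →L[ℝ] E) (a b : E) :
    g₀ (σ[X] a) b = g₀ (X b) a := by
  rw [ContinuousLinearMap.comp_apply, hS, ContinuousLinearMap.flip_apply,
    ContinuousLinearMap.comp_apply]

/-- The transpose is an anti-homomorphism: `σ (X Y) = σ Y σ X`. [folklore] -/
theorem bilin_transpose_mul (hpos : ∀ a, a ≠ 0 → 0 < g₀ a a) (hsymm : ∀ a b, g₀ a b = g₀ b a)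
    (hS : ∀ ℓ w, g₀ (S ℓ) w = ℓ w) [FiniteDimensional ℝ E] (X Y : E →L[ℝ] E) :
    σ[X * Y] = σ[Y] * σ[X] := by
  refine ContinuousLinearMap.ext fun a ↦ bilin_ext g₀ hpos fun w ↦ ?_
  rw [bilin_transpose_apply g₀ S hS, mul_apply_eq_comp, mul_apply_eq_comp,
    bilin_transpose_apply g₀ S hS, hsymm (Y w), bilin_transpose_apply g₀ S hS, hsymm]

/-- `σ 1 = 1`. [folklore] -/
theorem bilin_transpose_one (hpos : ∀ a, a ≠ 0 → 0 < g₀ a a) (hsymm : ∀ a b, g₀ a b = g₀ b a)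
    (hS : ∀ ℓ w, g₀ (S ℓ) w = ℓ w) [FiniteDimensional ℝ E] : σ[(1 : E →L[ℝ] E)] = 1 := by
  refine ContinuousLinearMap.ext fun a ↦ bilin_ext g₀ hpos fun w ↦ ?_
  rw [bilin_transpose_apply g₀ S hS, one_apply_eq_self, one_apply_eq_self, hsymm]

/-- The transpose is continuous (a composition of continuous linear operations). [folklore] -/
theorem continuous_bilin_transpose :
    Continuous fun X : E →L[ℝ] E ↦ σ[X] :=
  ((ContinuousLinearMap.compL ℝ E (E →L[ℝ] ℝ) E S).continuous.comp
    ((ContinuousLinearMap.flipₗᵢ ℝ E E ℝ).continuous.comp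
      (ContinuousLinearMap.compL ℝ E E (E →L[ℝ] ℝ) g₀).continuous))

/-- The transpose as a continuous linear map in `X` (same formula). [folklore] -/
theorem bilin_transpose_eq_clm (X : E →L[ℝ] E) :
    σ[X] = ((ContinuousLinearMap.compL ℝ E (E →L[ℝ] ℝ) E S).comp
      (((ContinuousLinearMap.flipₗᵢ ℝ E E ℝ).toContinuousLinearEquiv : _ →L[ℝ] _).comp
        (ContinuousLinearMap.compL ℝ E E (E →L[ℝ] ℝ) g₀))) X := by
  rfl

/-- An operator is `g₀`-self-adjoint iff it is fixed by the transpose. [folklore] -/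
theorem bilin_transpose_eq_self_iff (hpos : ∀ a, a ≠ 0 → 0 < g₀ a a)
    (hsymm : ∀ a b, g₀ a b = g₀ b a) (hS : ∀ ℓ w, g₀ (S ℓ) w = ℓ w) [FiniteDimensional ℝ E]
    (X : E →L[ℝ] E) : σ[X] = X ↔ ∀ a b, g₀ (X a) b = g₀ a (X b) := by
  constructor
  · intro h a b
    rw [← h, bilin_transpose_apply g₀ S hS, hsymm, h]
  · intro h
    refine ContinuousLinearMap.ext fun a ↦ bilin_ext g₀ hpos fun w ↦ ?_
    rw [bilin_transpose_apply g₀ S hS, hsymm (X w), ← h, hsymm]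

end Transpose

section Koszul

variable {E : Type*} [NormedAddCommGroup E] [NormedSpace ℝ E]
  (g₀ : E →L[ℝ] E →L[ℝ] ℝ) (S : (E →L[ℝ] ℝ) →L[ℝ] E)

/-- **Existence of the Koszul map** of a metric jet `D` (`u ↦ D_u g`): a continuous bilinear
`B : E × E → E` with `g₀ (B u v) w = ½ (D u v w + D v u w - D w u v)` (Koszul's formula for the
Levi-Civita connection on constant vector fields), built from the Riesz map `S`.
[cite: Voisin2002, §3.2.1] -/
theorem exists_koszul [FiniteDimensional ℝ E] (hS : ∀ ℓ w, g₀ (S ℓ) w = ℓ w)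
    (D : E →L[ℝ] E →L[ℝ] E →L[ℝ] ℝ) :
    ∃ B : E →L[ℝ] E →L[ℝ] E, ∀ u v w, g₀ (B u v) w = 2⁻¹ * (D u v w + D v u w - D w u v) := by
  -- the Koszul functional `K u v = ½ (D u v + D v u - D · u v)` and `B u v = S (K u v)`
  let K : E → E → (E →L[ℝ] ℝ) := fun u v ↦ (2⁻¹ : ℝ) • (D u v + D v u - (D.flip u).flip v)
  have hK : ∀ u v w, K u v w = 2⁻¹ * (D u v w + D v u w - D w u v) := fun u v w ↦ by
    simp only [K, _root_.smul_apply, _root_.add_apply, _root_.sub_apply,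
      ContinuousLinearMap.flip_apply, smul_eq_mul]
  have hKadd₁ : ∀ u u' v, K (u + u') v = K u v + K u' v := fun u u' v ↦ by
    ext w; simp only [hK, _root_.add_apply, map_add]; ring
  have hKsmul₁ : ∀ (r : ℝ) u v, K (r • u) v = r • K u v := fun r u v ↦ by
    ext w; simp only [hK, _root_.smul_apply, map_smul, smul_eq_mul]; ring
  have hKadd₂ : ∀ u v v', K u (v + v') = K u v + K u v' := fun u v v' ↦ by
    ext w; simp only [hK, _root_.add_apply, map_add]; ring
  have hKsmul₂ : ∀ (r : ℝ) u v, K u (r • v) = r • K u v := fun r u v ↦ by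
    ext w; simp only [hK, _root_.smul_apply, map_smul, smul_eq_mul]; ring
  let Bₗ : E →ₗ[ℝ] E →ₗ[ℝ] E := LinearMap.mk₂ ℝ (fun u v ↦ S (K u v))
    (fun u u' v ↦ by rw [hKadd₁, map_add]) (fun r u v ↦ by rw [hKsmul₁, map_smul])
    (fun u v v' ↦ by rw [hKadd₂, map_add]) (fun r u v ↦ by rw [hKsmul₂, map_smul])
  let Bc : E →ₗ[ℝ] E →L[ℝ] E :=
    (LinearMap.toContinuousLinearMap : (E →ₗ[ℝ] E) ≃ₗ[ℝ] E →L[ℝ] E).toLinearMap.comp Bₗ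
  refine ⟨LinearMap.toContinuousLinearMap Bc, fun u v w ↦ ?_⟩
  change g₀ (S (K u v)) w = _
  rw [hS, hK]

variable {g₀}

/-- **Torsion-freeness** of the Koszul map: `B u v = B v u` when each `D_u g` is symmetric.
[cite: Voisin2002, §3.2.1] -/
theorem koszul_symm' (hpos : ∀ a, a ≠ 0 → 0 < g₀ a a) [FiniteDimensional ℝ E]
    {D : E →L[ℝ] E →L[ℝ] E →L[ℝ] ℝ} (hDsymm : ∀ u a b, D u a b = D u b a) {B : E →L[ℝ] E →L[ℝ] E}
    (hB : ∀ u v w, g₀ (B u v) w = 2⁻¹ * (D u v w + D v u w - D w u v)) (u v : E) :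
    B u v = B v u := by
  refine bilin_ext g₀ hpos fun w ↦ ?_
  rw [hB, hB, hDsymm w u v]
  ring

/-- **Metric compatibility** of the Koszul map: `D u v w = g₀ (B u v) w + g₀ v (B u w)` — for the
quadratic change of coordinates `φ(z) = z + ½B(z,z)` this says that the first jet of the transported
metric vanishes (Voisin (2002), Prop. 3.14). [cite: Voisin2002, Prop. 3.14] -/
theorem koszul_metric' (hsymm : ∀ a b, g₀ a b = g₀ b a) {D : E →L[ℝ] E →L[ℝ] E →L[ℝ] ℝ}
    (hDsymm : ∀ u a b, D u a b = D u b a) {B : E →L[ℝ] E →L[ℝ] E}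
    (hB : ∀ u v w, g₀ (B u v) w = 2⁻¹ * (D u v w + D v u w - D w u v)) (u v w : E) :
    D u v w = g₀ (B u v) w + g₀ v (B u w) := by
  rw [hsymm v (B u w), hB, hB, hDsymm u w v, hDsymm w u v, hDsymm v u w]
  ring

/-- **Kähler ⇒ the Koszul map is `ℂ`-bilinear** (Voisin's Prop. 3.14 / Thm. 3.13), for a `g₀`-skew
complex structure `J` (`g₀ (J a) b = -g₀ a (J b)`, `J (J v) = -v`), a symmetric Hermitian jet
(`D u (J a) (J b) = D u a b`) and the Kähler relation `D u (Jv) w - D v (Ju) w + D w (Ju) v = 0`: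
`B u (J v) = J (B u v)`. Same computation as `koszul_J` (`KaehlerOsculatingAlgebraProofs.lean`).
[cite: Voisin2002, Thm. 3.13, Prop. 3.14] -/
theorem koszul_J' (hpos : ∀ a, a ≠ 0 → 0 < g₀ a a) [FiniteDimensional ℝ E]
    {D : E →L[ℝ] E →L[ℝ] E →L[ℝ] ℝ} (J : E →L[ℝ] E)
    (hJJ : ∀ v, J (J v) = -v) (hJskew : ∀ a b, g₀ (J a) b = -g₀ a (J b))
    (hDsymm : ∀ u a b, D u a b = D u b a) (hDJ : ∀ u a b, D u (J a) (J b) = D u a b)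
    (hK : ∀ u v w, D u (J v) w - D v (J u) w + D w (J u) v = 0) {B : E →L[ℝ] E →L[ℝ] E}
    (hB : ∀ u v w, g₀ (B u v) w = 2⁻¹ * (D u v w + D v u w - D w u v)) (u v : E) :
    B u (J v) = J (B u v) := by
  refine bilin_ext g₀ hpos fun w ↦ ?_
  rw [hJskew, hB, hB]
  have hmix : ∀ a b c, D a b (J c) = -D a (J b) c := fun a b c ↦ by
    have := hDJ a (J b) c
    rw [hJJ, map_neg, neg_apply] at this
    linarith
  have k1 := hK (J v) (J u) w
  have k2 := hK (J w) (J u) v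
  simp only [hJJ, map_neg, neg_apply] at k1 k2
  have e1 : D u (J v) w + D u v (J w) = 0 := by rw [hmix u v w]; ring
  have e2 : D w v (J u) = -D w (J v) u := hmix w v u
  have e3 : D w u (J v) = -D w (J u) v := hmix w u v
  have e4 : D v u (J w) = -D v (J u) w := hmix v u w
  have e5 : D v w (J u) = -D v (J w) u := hmix v w u
  have s1 := hDsymm (J u) v w
  have s3 := hDsymm w (J u) v
  have s4 := hDsymm v (J u) w
  linarith

end Koszul

/-! ### §4 The frame: `A y = 1 + B(y - c)`, the Gram operator `Q y`, and their first properties -/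

section Frame

variable {E : Type*} [NormedAddCommGroup E] [NormedSpace ℝ E]
  (g₀ : E →L[ℝ] E →L[ℝ] ℝ) (S : (E →L[ℝ] ℝ) →L[ℝ] E) (B : E →L[ℝ] E →L[ℝ] E)
  (Ĝ : E → E →L[ℝ] E →L[ℝ] ℝ) (c : E)

/-- The differential `A y = 1 + B(y - c)` of the quadratic coordinate change. -/
local notation "A[" y "]" => ((1 : E →L[ℝ] E) + B (y - c))

/-- Its inverse (in the Banach algebra `E →L[ℝ] E`). -/
local notation "Ai[" y "]" => Ring.inverse ((1 : E →L[ℝ] E) + B (y - c))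

/-- The transported metric `(a, b) ↦ Ĝ y (A y⁻¹ a) (A y⁻¹ b)`. -/
local notation "Qf[" y "]" => ContinuousLinearMap.bilinearComp (Ĝ y) (Ai[y]) (Ai[y])

/-- Its `g₀`-Gram operator `Q y = S ∘ Qf y` (`g₀ (Q y a) b = Qf y a b`). -/
local notation "Q[" y "]" => ContinuousLinearMap.comp S (Qf[y])

/-- `A c = 1`. [folklore] -/
theorem frameA_apply_c : A[c] = 1 := by
  rw [sub_self, map_zero, add_zero]

/-- `DA(c) = B`: the differential of `y ↦ 1 + B(y - c)` at `c` is `B`. [folklore] -/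
theorem hasFDerivAt_frameA : HasFDerivAt (fun y ↦ A[y]) B c := by
  have h : HasFDerivAt (fun y ↦ B (y - c)) (B.comp (ContinuousLinearMap.id ℝ E)) c :=
    B.hasFDerivAt.comp c ((hasFDerivAt_id c).sub_const c)
  rw [ContinuousLinearMap.comp_id] at h
  exact h.const_add 1

/-- `A` is smooth (affine). [folklore] -/
theorem contDiff_frameA {n : WithTop ℕ∞} : ContDiff ℝ n fun y ↦ A[y] :=
  contDiff_const.add (B.contDiff.comp (contDiff_id.sub contDiff_const))

/-- `A y` is invertible for `y` near `c`. [folklore] -/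
theorem eventually_isUnit_frameA [CompleteSpace E] : ∀ᶠ y in 𝓝 c, IsUnit A[y] := by
  have hc : ContinuousAt (fun y ↦ A[y]) c := (contDiff_frameA B c (n := 0)).continuous.continuousAt
  have h : ∀ᶠ X in 𝓝 ((fun y ↦ A[y]) c), IsUnit X := by
    rw [show (fun y ↦ A[y]) c = 1 from frameA_apply_c B c]
    exact Units.isOpen.mem_nhds isUnit_one
  exact hc.eventually h

/-- `g₀ (Q y a) b = Ĝ y (A y⁻¹ a) (A y⁻¹ b)`. [folklore] -/
theorem frameQ_apply (hS : ∀ ℓ w, g₀ (S ℓ) w = ℓ w) (y a b : E) :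
    g₀ (Q[y] a) b = Ĝ y (Ai[y] a) (Ai[y] b) := by
  rw [ContinuousLinearMap.comp_apply, hS, ContinuousLinearMap.bilinearComp_apply]

/-- `Q c = 1` when `Ĝ c = g₀`. [folklore] -/
theorem frameQ_apply_c (hpos : ∀ a, a ≠ 0 → 0 < g₀ a a) (hS : ∀ ℓ w, g₀ (S ℓ) w = ℓ w)
    [FiniteDimensional ℝ E] (hĜc : Ĝ c = g₀) : Q[c] = 1 := by
  refine ContinuousLinearMap.ext fun a ↦ bilin_ext g₀ hpos fun w ↦ ?_
  rw [frameQ_apply g₀ S B Ĝ c hS, hĜc, sub_self, map_zero, add_zero, Ring.inverse_one,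
    one_apply_eq_self, one_apply_eq_self]

/-- `Q y` is `g₀`-self-adjoint (for symmetric `Ĝ y` and `g₀`). [folklore] -/
theorem frameQ_selfAdjoint (hsymm : ∀ a b, g₀ a b = g₀ b a) (hS : ∀ ℓ w, g₀ (S ℓ) w = ℓ w)
    (hĜsymm : ∀ y a b, Ĝ y a b = Ĝ y b a) (y a b : E) : g₀ (Q[y] a) b = g₀ a (Q[y] b) := by
  rw [frameQ_apply g₀ S B Ĝ c hS, hsymm a, frameQ_apply g₀ S B Ĝ c hS, hĜsymm]

/-- The bilinear composition `(f, g, h) ↦ f.bilinearComp g h` is smooth. [folklore] -/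
theorem contDiff_bilinearComp {n : WithTop ℕ∞} :
    ContDiff ℝ n fun p : (E →L[ℝ] E →L[ℝ] ℝ) × (E →L[ℝ] E) × (E →L[ℝ] E) ↦
      p.1.bilinearComp p.2.1 p.2.2 := by
  have hflip : ContDiff ℝ n fun X : E →L[ℝ] E →L[ℝ] ℝ ↦ X.flip := by
    refine IsBoundedLinearMap.contDiff
      { map_add := fun X Y ↦ ContinuousLinearMap.flip_add X Y
        map_smul := fun r X ↦ ContinuousLinearMap.flip_smul r X
        bound := ⟨1, one_pos, fun X ↦ ?_⟩ }
    rw [one_mul, ContinuousLinearMap.opNorm_flip]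
  have hc : ContDiff ℝ n fun q : (E →L[ℝ] E →L[ℝ] ℝ) × (E →L[ℝ] E) ↦ q.1.comp q.2 :=
    (isBoundedBilinearMap_comp (𝕜 := ℝ) (E := E) (F := E) (G := E →L[ℝ] ℝ)).contDiff
  have h1 : ContDiff ℝ n fun p : (E →L[ℝ] E →L[ℝ] ℝ) × (E →L[ℝ] E) × (E →L[ℝ] E) ↦
      (p.1.comp p.2.1).flip :=
    hflip.comp (hc.comp (contDiff_fst.prodMk (contDiff_fst.comp contDiff_snd)))
  exact hflip.comp (hc.comp (h1.prodMk (contDiff_snd.comp contDiff_snd)))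

/-- **Smoothness of the Gram operator**: if `Ĝ` is `C^n` at `y` and `A y` is invertible then
`Q` is `C^n` at `y`. [folklore] -/
theorem contDiffAt_frameQ [CompleteSpace E] {n : WithTop ℕ∞} {y : E} (hĜ : ContDiffAt ℝ n Ĝ y)
    (hA : IsUnit A[y]) : ContDiffAt ℝ n (fun y ↦ Q[y]) y := by
  have hAi : ContDiffAt ℝ n (fun y ↦ Ai[y]) y := by
    have h1 : ContDiffAt ℝ n Ring.inverse A[y] := contDiffAt_ringInverse ℝ hA.unit
    exact ContDiffAt.comp (f := fun y ↦ A[y]) y h1 (contDiff_frameA B c).contDiffAt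
  have h3 : ContDiffAt ℝ n (fun y ↦ (Ĝ y, Ai[y], Ai[y])) y := hĜ.prodMk (hAi.prodMk hAi)
  have hQf : ContDiffAt ℝ n ((fun p : (E →L[ℝ] E →L[ℝ] ℝ) × (E →L[ℝ] E) × (E →L[ℝ] E) ↦
      p.1.bilinearComp p.2.1 p.2.2) ∘ (fun y ↦ (Ĝ y, Ai[y], Ai[y]))) y := by
    have hg := (contDiff_bilinearComp (E := E) (n := n)).contDiffAt
      (x := (fun y ↦ (Ĝ y, Ai[y], Ai[y])) y)
    exact ContDiffAt.comp y hg h3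
  have h5 := (ContinuousLinearMap.compL ℝ E (E →L[ℝ] ℝ) E S).contDiff (n := n) |>.contDiffAt.comp y hQf
  have e : (fun y ↦ Q[y]) = ⇑(ContinuousLinearMap.compL ℝ E (E →L[ℝ] ℝ) E S) ∘
      ((fun p : (E →L[ℝ] E →L[ℝ] ℝ) × (E →L[ℝ] E) × (E →L[ℝ] E) ↦
        p.1.bilinearComp p.2.1 p.2.2) ∘ (fun y ↦ (Ĝ y, Ai[y], Ai[y]))) := by
    funext y
    simp only [Function.comp_apply, ContinuousLinearMap.compL_apply]
  rw [e]
  exact h5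

/-- `Q` is continuous at `c` (with value `1`) when `Ĝ` is. [folklore] -/
theorem continuousAt_frameQ [CompleteSpace E] (hĜ : ContinuousAt Ĝ c) :
    ContinuousAt (fun y ↦ Q[y]) c := by
  have hAi : ContinuousAt (fun y ↦ Ai[y]) c := by
    have hA : IsUnit A[c] := by
      rw [frameA_apply_c B c]
      exact isUnit_one
    have h1 : ContinuousAt Ring.inverse A[c] := NormedRing.inverse_continuousAt hA.unit
    exact ContinuousAt.comp (f := fun y ↦ A[y]) (x := c) h1
      (contDiff_frameA B c (n := 0)).continuous.continuousAt
  have h3 : ContinuousAt (fun y ↦ (Ĝ y, Ai[y], Ai[y])) c := hĜ.prodMk (hAi.prodMk hAi)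
  have hQf : ContinuousAt ((fun p : (E →L[ℝ] E →L[ℝ] ℝ) × (E →L[ℝ] E) × (E →L[ℝ] E) ↦
      p.1.bilinearComp p.2.1 p.2.2) ∘ (fun y ↦ (Ĝ y, Ai[y], Ai[y]))) c := by
    have hg := (contDiff_bilinearComp (E := E) (n := 0)).continuous.continuousAt
      (x := (fun y ↦ (Ĝ y, Ai[y], Ai[y])) c)
    exact ContinuousAt.comp hg h3
  have h5 := (ContinuousLinearMap.compL ℝ E (E →L[ℝ] ℝ) E S).continuous.continuousAt.comp hQf
  have e : (fun y ↦ Q[y]) = ⇑(ContinuousLinearMap.compL ℝ E (E →L[ℝ] ℝ) E S) ∘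
      ((fun p : (E →L[ℝ] E →L[ℝ] ℝ) × (E →L[ℝ] E) × (E →L[ℝ] E) ↦
        p.1.bilinearComp p.2.1 p.2.2) ∘ (fun y ↦ (Ĝ y, Ai[y], Ai[y]))) := by
    funext y
    simp only [Function.comp_apply, ContinuousLinearMap.compL_apply]
  rw [e]
  exact h5

end Frame

end Literature.Geometry.Kaehler
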